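import Literature.AlgebraicGeometry.AbelianSchemes.AbelianSchemeOverField
import Literature.AlgebraicGeometry.Motives.AbelianVarietyBaseChange
import HarnessLib

/-!
# Fibres of an abelian scheme over an affine base at field-valued points, and their endomorphisms
# (Shimura 1998 §12.4 Prop. 26, proof p. 109: «take a specialization … `(A′, ι′)`»; Mumford–Fogarty–Kirwan Ch. 6 §1)

Topic `Literature/AlgebraicGeometry/AbelianSchemes`; namespace `Literature.AlgebraicGeometry.AbelianSchemes.AbelianScheme`.
Cell `hodgecm-mathlib` (D-0151), row II-2β (`shimura1998_prop26_definedOverQbar` `_holds` programme, plan of record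
`A-provers/A-p03/PREP-II2beta-Prop26Qbar.md` (S3); A-p14's S1-F3 cut 03:52:57Z «GroupSchemeFieldFibre», director g1 03:41:02Z).
SEQUEL of `AbelianSchemeAffineBase` (`AbelianScheme R`, `AbelianScheme.baseChange φ`) and `AbelianSchemeOverField`
(`AbelianScheme.toAbelianVariety`): ONE definition with body of each kind (`fibre`, `fibreEnd`) + theorems; no named fact, no
instance, no `sorry` (net debt 0).  HC_CM is proved only modulo the 7 printed citations until rung 0 closes.

THE PRINT.  [Shimura1998] §12.4 Prop. 26, proof p. 109: the structure `(A, ι)` is defined over a finitely generated field; «take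
a specialization […] over `ℚ̄` […] we obtain a structure `(A′, ι′)`» — `A′` is the fibre of a model of `A` over a finitely generated
`ℚ̄`-algebra at a `ℚ̄`-point, `ι′(a)` the specialisation of the endomorphism `ι(a)`; [MilneCM2006] Prop. 7.10, proof: «the fibre of
`(𝒜, i)` over a closed point».  [MumfordFogartyKirwan1994] Ch. 6 §1 Def. 6.1 (p. 115): abelian schemes (smooth proper group schemes
with connected geometric fibres); over a field they are abelian varieties.

WHAT IS HERE (CM-free; `𝒜 : AbelianScheme R`, `R` any commutative ring, `φ : R →+* κ` to a FIELD `κ`; `F_φ := Over.pullback (Spec φ)`).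
* §1 `fibre 𝒜 φ : AbelianVariety κ` := `(𝒜.baseChange φ).toAbelianVariety` — the FIBRE `𝒜 ×_{Spec R} Spec κ` as an abelian variety
  over `κ` (group law transported along the cartesian-monoidal `F_φ`; proper, smooth, geometrically connected by base change, hence
  geometrically integral over the field, `AbelianSchemeOverField`); rfl lemmas `fibre_X`, `fibre_toGrp`.
* §2 `fibreEnd 𝒜 φ f : End (𝒜.fibre φ)` for an endomorphism `f : 𝒜.X ⟶ 𝒜.X` of GROUP schemes over `R` (`[IsMonHom f]`): the base
  change `F_φ.mapGrp.map f`, with `fibreEnd_hom_hom_hom` (its underlying `κ`-morphism is `F_φ.map f`), `fibreEnd_id`, `fibreEnd_comp`,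
  and ADDITIVITY `fibreEnd_mul` (`F_φ (f·g) = F_φ f + F_φ g`: Mathlib `Functor.map_mul` for the monoidal `F_φ`; the sum of
  homomorphisms of abelian varieties is the pointwise product, `Motives.AbelianVariety.hom_add`).
* §3 **«`ι′`»** `exists_ringHom_fibreEnd`: a PRESENTED action of a commutative ring `O` on `𝒜` by group-scheme endomorphisms —
  a function `ιR : O → (𝒜.X ⟶ 𝒜.X)` with `IsMonHom (ιR a)`, `ιR 1 = 𝟙`, `ιR (a b) = ιR a ≫ ιR b`, `ιR (a + b) = ιR a · ιR b` (the
  finitely many identities a spread carries to a stage, A-p14 `Limits/SubalgebraEndomorphismSpread`) — specialises to a RING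
  HOMOMORPHISM `ι_φ : O →+* End (𝒜.fibre φ)` with `(ι_φ a).hom.hom.hom = F_φ.map (ιR a)`.  With `O = 𝓞 K`, `φ = u : T′ → ℚ̄` this is the
  `(𝒜_u, ι_u)` of the plan; with `φ = ψ : T′ ↪ ℂ` it recovers `(A, ι)` up to the iso of A-p14's S1-F2.
* §4 (interface for A-p03's `Motives/AbelianVarietyCotangentOfFibre`, CM-free) the fibre as a PULLBACK SQUARE with projection
  `p := pullback.fst 𝒜.X.hom (Spec φ) : 𝒜_φ → 𝒜`: `isPullback_fibre` (`IsPullback p (𝒜_φ → Spec κ) (𝒜 → Spec R) (Spec φ)`),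
  `toSchemeHom_fibreEnd_comp_fst` (`f_φ ≫ p = p ≫ f`), `unitPt_fibre_comp_fst` (the ORIGIN: `e_{𝒜_φ} ≫ p = Spec φ ≫ e_𝒜`, via Mathlib
  `Functor.obj.η_def` + `Functor.Monoidal.ε_η` + `Over.η_pullback_left`), and the two identities of `f` itself, `left_comp_hom` (`f` is over `Spec R`) and
  `unit_left_comp_left` (`e_𝒜 ≫ f = e_𝒜` for a homomorphism).
NOT HERE: the spread (A-p14 S1-F1/F2), `ℚ̄`-points and the basis presentation of `𝓞 K` (A-p11 p603882
`CMStructureSpecialisationAlgebra`), the type of the fibre (A-p03 p602431/p602731/p603050/p603294), the descent (B-p06 p602371/p603159).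

## References
* [Shimura1998] G. Shimura, *Abelian Varieties with Complex Multiplication and Modular Functions* (1998), §12.4 Prop. 26 (proof p. 109).
* [MilneCM2006] J. S. Milne, *Complex Multiplication* (2006), Prop. 7.10 (proof).
* [MumfordFogartyKirwan1994] D. Mumford, J. Fogarty, F. Kirwan, *Geometric Invariant Theory*, 3rd ed. (1994), Ch. 6 §1 Def. 6.1 (p. 115).
* [GortzWedhorn2020] U. Görtz, T. Wedhorn, *Algebraic Geometry I* (2020), Section (4.7), Remark 16.54.
-/

set_option autoImplicit false

universe u

open CategoryTheory CategoryTheory.Limits AlgebraicGeometry MonoidalCategory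

noncomputable section

namespace Literature.AlgebraicGeometry.AbelianSchemes

namespace AbelianScheme

open Literature.AlgebraicGeometry.Motives (SchemeOver AbelianVariety)
open scoped MonObj Obj

variable {R : Type u} [CommRing R] (𝒜 : AbelianScheme R) {κ : Type u} [Field κ] (φ : R →+* κ)

/-! ## §1 The fibre at a field-valued point is an abelian variety -/

/-- **The fibre `𝒜_φ = 𝒜 ×_{Spec R} Spec κ` of an abelian scheme at a field-valued point `φ : R → κ` is an abelian variety over `κ`**
(base change of the abelian scheme along `φ`, then «abelian scheme over a field = abelian variety»).  Shimura's `A′`, Milne's «fibre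
over a closed point». [cite: Shimura1998, §12.4 Prop. 26 (proof, p. 109)] [cite: MumfordFogartyKirwan1994, Ch. 6 §1 Def. 6.1 (p. 115)] -/
def fibre : AbelianVariety κ := (𝒜.baseChange φ).toAbelianVariety

/-- The underlying `κ`-scheme of the fibre is `(Over.pullback (Spec φ)).obj 𝒜.X`. [cite: GortzWedhorn2020, Section (4.7)] -/
@[simp]
theorem fibre_X : (𝒜.fibre φ).X = (Over.pullback (specMap φ)).obj 𝒜.X := rfl

/-- The underlying scheme of the fibre is `𝒜 ×_{Spec R} Spec κ`. [cite: GortzWedhorn2020, Section (4.7)] -/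
theorem fibre_left : (𝒜.fibre φ).X.left = pullback 𝒜.X.hom (specMap φ) := rfl

/-- The group structure of the fibre is the transported one (`Functor.grpObjObj` for `Over.pullback (Spec φ)`), i.e. the group
`κ`-scheme of the fibre is `(Over.pullback (Spec φ)).mapGrp.obj 𝒜.toGrp`. [cite: GortzWedhorn2020, Remark 16.54] -/
theorem fibre_toGrp : (𝒜.fibre φ).toGrp = (Over.pullback (specMap φ)).mapGrp.obj 𝒜.toGrp := rfl

/-! ## §2 Specialising an endomorphism of group schemes -/

/-- **The specialisation `f_φ` of a group-scheme endomorphism `f` of `𝒜`** (Shimura's `ι′(a)` for `f = ι(a)`): the base change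
`(Over.pullback (Spec φ)).mapGrp.map f`, an endomorphism of the abelian variety `𝒜_φ`.
[cite: Shimura1998, §12.4 Prop. 26 (proof, p. 109: «(A′, ι′)»)] [cite: GortzWedhorn2020, Remark 16.54] -/
def fibreEnd (f : 𝒜.X ⟶ 𝒜.X) [IsMonHom f] : End (𝒜.fibre φ) :=
  InducedCategory.homMk ((Over.pullback (specMap φ)).mapGrp.map (Grp.ofHom f))

/-- The underlying morphism of `κ`-schemes of `f_φ` is the base change `(Over.pullback (Spec φ)).map f`.
[cite: GortzWedhorn2020, Section (4.7)] -/
@[simp]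
theorem fibreEnd_hom_hom_hom (f : 𝒜.X ⟶ 𝒜.X) [IsMonHom f] :
    (𝒜.fibreEnd φ f).hom.hom.hom = (Over.pullback (specMap φ)).map f := rfl

/-- `(𝟙)_φ = 𝟙`. [cite: GortzWedhorn2020, Section (4.7)] -/
theorem fibreEnd_id : 𝒜.fibreEnd φ (𝟙 𝒜.X) = 𝟙 (𝒜.fibre φ) := by
  apply AbelianVariety.hom_ext
  change (Over.pullback (specMap φ)).map (𝟙 𝒜.X) = 𝟙 ((Over.pullback (specMap φ)).obj 𝒜.X)
  exact (Over.pullback (specMap φ)).map_id _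

/-- `(f ≫ g)_φ = f_φ ≫ g_φ`. [cite: GortzWedhorn2020, Section (4.7)] -/
theorem fibreEnd_comp (f g : 𝒜.X ⟶ 𝒜.X) [IsMonHom f] [IsMonHom g] :
    𝒜.fibreEnd φ (f ≫ g) = 𝒜.fibreEnd φ f ≫ 𝒜.fibreEnd φ g := by
  apply AbelianVariety.hom_ext
  rw [fibreEnd_hom_hom_hom, Functor.map_comp]
  rfl

/-- **Additivity of specialisation**: for homomorphisms `f, g` whose pointwise product `f·g` (Mathlib's `Hom.group` on
`Hom(𝒜, 𝒜)`) is again a homomorphism, `(f·g)_φ = f_φ + g_φ` — base change along the cartesian-monoidal `Over.pullback (Spec φ)`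
preserves pointwise products (Mathlib `Functor.map_mul`), and the sum of homomorphisms of abelian varieties IS the pointwise
product (`Motives.AbelianVariety.hom_add`). [cite: GortzWedhorn2020, Remark 16.54] [cite: Shimura1998, §12.4 Prop. 26 (proof, p. 109)] -/
theorem fibreEnd_mul (f g : 𝒜.X ⟶ 𝒜.X) [IsMonHom f] [IsMonHom g] [IsMonHom (f * g)] :
    𝒜.fibreEnd φ (f * g) = 𝒜.fibreEnd φ f + 𝒜.fibreEnd φ g := by
  apply AbelianVariety.hom_ext
  change (Over.pullback (specMap φ)).map (f * g) =
    (Over.pullback (specMap φ)).map f * (Over.pullback (specMap φ)).map g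
  exact Functor.map_mul (Over.pullback (specMap φ)) f g

/-! ## §3 «`ι′`»: a presented ring of endomorphisms specialises to a ring homomorphism into `End (𝒜_φ)` -/

/-- **Shimura's `ι′ : O → End A′`.**  Let a commutative ring `O` act on the abelian scheme `𝒜/R` through a PRESENTATION by
group-scheme endomorphisms: a function `ιR : O → (𝒜.X ⟶ 𝒜.X)`, each `ιR a` a homomorphism, with `ιR 1 = 𝟙`, `ιR (a b) = ιR a ≫ ιR b`
and `ιR (a + b) = ιR a · ιR b` (pointwise product).  Then at every field-valued point `φ : R → κ` the specialisations
`a ↦ (ιR a)_φ` form a RING HOMOMORPHISM `ι_φ : O →+* End (𝒜_φ)` whose underlying `κ`-morphisms are the base changes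
`(Over.pullback (Spec φ)).map (ιR a)`.  (`End` multiplication is composition in either order — `O` is commutative.)
[cite: Shimura1998, §12.4 Prop. 26 (proof, p. 109: «we obtain a structure (A′, ι′)»)] [cite: MilneCM2006, Prop. 7.10 (proof)] -/
theorem exists_ringHom_fibreEnd {O : Type*} [CommRing O] (ιR : O → (𝒜.X ⟶ 𝒜.X)) [hmon : ∀ a, IsMonHom (ιR a)]
    (h1 : ιR 1 = 𝟙 𝒜.X) (hmul : ∀ a b, ιR (a * b) = ιR a ≫ ιR b) (hadd : ∀ a b, ιR (a + b) = ιR a * ιR b) :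
    ∃ ικ : O →+* End (𝒜.fibre φ), ∀ a, (ικ a).hom.hom.hom = (Over.pullback (specMap φ)).map (ιR a) := by
  -- the monoid homomorphism `a ↦ (ιR a)_φ`
  have hone : 𝒜.fibreEnd φ (ιR 1) = 1 := by
    apply AbelianVariety.hom_ext
    rw [fibreEnd_hom_hom_hom, h1]
    change (Over.pullback (specMap φ)).map (𝟙 𝒜.X) = 𝟙 ((Over.pullback (specMap φ)).obj 𝒜.X)
    exact (Over.pullback (specMap φ)).map_id _
  have hmul' : ∀ a b, 𝒜.fibreEnd φ (ιR (a * b)) = 𝒜.fibreEnd φ (ιR a) * 𝒜.fibreEnd φ (ιR b) := by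
    intro a b
    apply AbelianVariety.hom_ext
    rw [End.mul_def, fibreEnd_hom_hom_hom, mul_comm, hmul, Functor.map_comp]
    rfl
  have hadd' : ∀ a b, 𝒜.fibreEnd φ (ιR (a + b)) = 𝒜.fibreEnd φ (ιR a) + 𝒜.fibreEnd φ (ιR b) := by
    intro a b
    apply AbelianVariety.hom_ext
    rw [fibreEnd_hom_hom_hom, hadd]
    change (Over.pullback (specMap φ)).map (ιR a * ιR b) =
      (Over.pullback (specMap φ)).map (ιR a) * (Over.pullback (specMap φ)).map (ιR b)
    exact Functor.map_mul (Over.pullback (specMap φ)) (ιR a) (ιR b)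
  let m : O →* End (𝒜.fibre φ) :=
    { toFun := fun a => 𝒜.fibreEnd φ (ιR a), map_one' := hone, map_mul' := hmul' }
  exact ⟨RingHom.mk' m hadd', fun a => rfl⟩

/-! ## §4 The fibre square, its origin, and the equivariance of the projection
(the hypotheses `(hP) (horig) (hu) (hv) (hev)` of `Motives/AbelianVarietyCotangentOfFibre`, discharged for `𝒜_φ`) -/

/-- **The fibre square is cartesian**: with the projection `p := pullback.fst : 𝒜_φ = 𝒜 ×_{Spec R} Spec κ → 𝒜`, the square
`(p, 𝒜_φ → Spec κ ; 𝒜 → Spec R, Spec φ)` is a pullback square (the structure map of `𝒜_φ` IS `pullback.snd`, `AbelianScheme.baseChange_hom`).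
[cite: GortzWedhorn2020, Section (4.7)] -/
theorem isPullback_fibre :
    IsPullback (pullback.fst 𝒜.X.hom (specMap φ)) (𝒜.fibre φ).X.hom 𝒜.X.hom (specMap φ) :=
  IsPullback.of_hasPullback 𝒜.X.hom (specMap φ)

/-- **The projection is equivariant for specialised endomorphisms**: `f_φ ≫ p = p ≫ f` on underlying schemes
(`(Over.pullback (Spec φ)).map f` is `pullback.lift (p ≫ f) (𝒜_φ → Spec κ)`, Mathlib `Over.pullback_map_left`).
[cite: GortzWedhorn2020, Section (4.7)] -/
theorem toSchemeHom_fibreEnd_comp_fst (f : 𝒜.X ⟶ 𝒜.X) [IsMonHom f] :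
    AbelianVariety.Hom.toSchemeHom (𝒜.fibreEnd φ f) ≫ pullback.fst 𝒜.X.hom (specMap φ) =
      pullback.fst 𝒜.X.hom (specMap φ) ≫ f.left :=
  pullback.lift_fst _ _ _

/-- **The origin of the fibre lies over the unit section**: `e_{𝒜_φ} ≫ p = Spec φ ≫ e_𝒜`, where `e_{𝒜_φ} = unitPt (𝒜_φ) : Spec κ → 𝒜_φ`
and `e_𝒜 = η[𝒜].left : Spec R → 𝒜` are the unit sections.  (The unit of the transported group object is
`ε ≫ (Over.pullback (Spec φ)).map η`, Mathlib `Functor.obj.η_def`, and `ε.left ≫ pullback.snd (𝟙 (Spec R)) (Spec φ) = 𝟙`,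
Mathlib `Functor.Monoidal.ε_η` with `Over.η_pullback_left`.) [cite: GortzWedhorn2020, Remark 16.54] -/
theorem unitPt_fibre_comp_fst :
    AbelianVariety.unitPt (𝒜.fibre φ) ≫ pullback.fst 𝒜.X.hom (specMap φ) = specMap φ ≫ η[𝒜.X].left := by
  -- `(F_φ.map η).left ≫ p = pullback.fst (𝟙 (Spec R)) (Spec φ) ≫ η.left` (`F_φ.map η` is a `pullback.lift`)
  have h1 : ((Over.pullback (specMap φ)).map η[𝒜.X]).left ≫ pullback.fst 𝒜.X.hom (specMap φ) =
      pullback.fst (𝟙 (Spec (.of R))) (specMap φ) ≫ η[𝒜.X].left :=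
    pullback.lift_fst _ _ _
  -- the pullback of `𝟙 (Spec R)` along `Spec φ`: `fst = snd ≫ Spec φ`
  have h2 : pullback.fst (𝟙 (Spec (.of R))) (specMap φ) = pullback.snd (𝟙 (Spec (.of R))) (specMap φ) ≫ specMap φ := by
    simpa using pullback.condition (f := 𝟙 (Spec (.of R))) (g := specMap φ)
  -- `ε.left ≫ snd = 𝟙`: `ε ≫ η = 𝟙` for the monoidal `F_φ` (`Functor.Monoidal.ε_η`) and `η.left = pullback.snd (𝟙 (Spec R)) (Spec φ)`
  -- (Mathlib `Over.η_pullback_left`, `rfl`); hence `ε.left ≫ fst = ε.left ≫ snd ≫ Spec φ = Spec φ`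
  have hεη : (Functor.LaxMonoidal.ε (Over.pullback (specMap φ))).left ≫ pullback.snd (𝟙 (Spec (.of R))) (specMap φ) =
      𝟙 _ :=
    congrArg Over.Hom.left (Functor.Monoidal.ε_η (Over.pullback (specMap φ)))
  have h3 : (Functor.LaxMonoidal.ε (Over.pullback (specMap φ))).left ≫ pullback.fst (𝟙 (Spec (.of R))) (specMap φ) =
      specMap φ :=
    (congrArg (fun t => (Functor.LaxMonoidal.ε (Over.pullback (specMap φ))).left ≫ t) h2).trans <|
      (Category.assoc _ _ _).symm.trans <| (congrArg (fun t => t ≫ specMap φ) hεη).trans (Category.id_comp _)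
  -- the unit of the transported group object is `ε ≫ F_φ.map η` (`Functor.obj.η_def`, `rfl`), so `e_{𝒜_φ} ≫ p = ε.left ≫ ((F_φ.map η).left ≫ p)`
  have h0 : AbelianVariety.unitPt (𝒜.fibre φ) ≫ pullback.fst 𝒜.X.hom (specMap φ) =
      (Functor.LaxMonoidal.ε (Over.pullback (specMap φ))).left ≫
        (((Over.pullback (specMap φ)).map η[𝒜.X]).left ≫ pullback.fst 𝒜.X.hom (specMap φ)) :=
    Category.assoc _ _ _
  exact h0.trans <| (congrArg (fun t => (Functor.LaxMonoidal.ε (Over.pullback (specMap φ))).left ≫ t) h1).trans <|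
    (Category.assoc _ _ _).symm.trans <| congrArg (fun t => t ≫ η[𝒜.X].left) h3

/-- An endomorphism `f` of `𝒜` over `Spec R` commutes with the structure map: `f ≫ (𝒜 → Spec R) = (𝒜 → Spec R)`.
[cite: GortzWedhorn2020, Section (4.7)] -/
theorem left_comp_hom (f : 𝒜.X ⟶ 𝒜.X) : f.left ≫ 𝒜.X.hom = 𝒜.X.hom := Over.w f

/-- A homomorphism `f` of the group scheme `𝒜` preserves the unit section: `e_𝒜 ≫ f = e_𝒜`. [cite: GortzWedhorn2020, Remark 16.54] -/
theorem unit_left_comp_left (f : 𝒜.X ⟶ 𝒜.X) [IsMonHom f] : η[𝒜.X].left ≫ f.left = η[𝒜.X].left := by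
  rw [← Over.comp_left, IsMonHom.one_hom]

end AbelianScheme

end Literature.AlgebraicGeometry.AbelianSchemes

end
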